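import Literature.AnabelianGeometry.SemiGraphs.MetabelianLeafStarAnchorFreeCertificate
import Literature.AnabelianGeometry.SemiGraphs.IwahoriLeafAsymptoticMalnormal
import Literature.AnabelianGeometry.SemiGraphs.MetabelianLeafStarTreeWalk
import Literature.AnabelianGeometry.SemiGraphs.TemperedPiDecompositionEdgesStab
import Literature.AnabelianGeometry.SemiGraphs.TemperedPiFrameTransport
import Literature.AnabelianGeometry.SemiGraphs.TemperedVerticialNamedFactsProofs
import HarnessLib

/-!
# LEAF-LOCAL COLLAPSE in the tower of `𝒢⋆(p)`: two fixed glued edges at one leaf-type vertex have centre ends with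
# the same image at a lower level («EXOTIC-ISOLATION@STAR», file F3b)

Mochizuki, *Semi-graphs of anabelioids*, Publ. RIMS **42** (2006), §3, Theorem 3.7 (i), (iii) pp. 40–41,
Remark 2.2.1 p. 24 (branch stabilisers in a Galois tower), Def. 2.4 (iv) p. 26 (estranged branch groups)
[cite: MochizukiSemiAnbd2006, Thm 3.7(iii) pp.40-41].

PROOF-ONLY file (abc-iut cell, layer L3, row «EXOTIC-ISOLATION@STAR», seat abc-iut-L3-t8 gen 9; no definition, no
named fact).  Canonical chart of the rayless star `𝒢⋆(p) = metabelianLeafStar p`, centre sequence `P₀`, leaf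
sequences `P_n = leafSeq P₀ n`, `ψ₀ = psi0 P₀`, `ψ_n = psiLeaf P₀ n`, `s = Iw.lowHom n` (torus of the leaf `n`):

* `isOpen_ker_proj_comp_psiLeaf`, `ker_proj_comp_psiLeaf_anti`, `eq_one_of_forall_mem_ker_proj_comp_psiLeaf` —
  the level kernels `L i = ker(ρ_i ∘ ψ_n) ≤ Leaf n`: open, decreasing, with trivial intersection (Thm 3.7 (i),
  `verticialInjective_holds`);
* `exists_proj_eq_leafConj_of_fixes_gluedEdge` — reading an element through a fixed glued edge from the LEAF side
  (conjugator-free edge dictionary `EdgeSeq.exists_galE_eq_proj_of_fixes` + `decompHomE_toEdgeSeq`): the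
  level-`i` component of `d` is that of `x ψ_n(l s(κ) l⁻¹) x⁻¹`;
* **`exists_level_leafLocalCollapse`** (LEAF-LOCAL COLLAPSE) — for `d` seen by an `a`-character: for every `j`
  there is `I` such that at levels `i ≥ I`, if `d` fixes the glued edges of two centre translates
  `(x ψ_n(l₁))·P₀`, `(x ψ_n(l₂))·P₀` adjacent to the same leaf-type vertex `x·P_n`, then these two centre
  translates have THE SAME vertex at level `j` (`κ₁ ≢ 0 (p^{e₀})` by the `a`-character; ASYMPTOTIC
  MALNORMALITY of `s(ℤ_p) ≤ Leaf n`, file F3a `IwahoriLeafAsymptoticMalnormal.lean`, gives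
  `l₂⁻¹ l₁ ∈ s(ℤ_p)·L j`, and `ψ_n(s(t)) = ψ₀(θα n t)` fixes `P₀`'s vertices);
* `exists_centre_smul_of_branch`, `exists_leaf_smul_of_branch` — gen 6's one-step walk lemmas
  (`MetabelianLeafStarTreeWalk.lean`) with the EDGE identified as a glued edge.

Consumer: F3 `MetabelianLeafStarPureTypeAnchored.lean` (pure type ⇒ anchored).  Honest framing: OUR typed tempered
fundamental group of OUR countable carrier `𝒢⋆(p)`; print's Thm 3.7 at finite `𝔾` untouched; nothing here bears
on [IUTchIII] Cor. 3.12; no side taken; typed ≠ proved.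
-/

noncomputable section

open CategoryTheory Topology Multiplicative Filter

namespace Literature.AnabelianGeometry.SemiGraphs

open IwahoriWitness

namespace ProfiniteSemiGraph

variable {p : ℕ} [hp : Fact p.Prime] {h36 : (metabelianLeafStar p).Prop36Hypotheses}
  (P₀ : ((metabelianLeafStar p).galoisLevelData h36).PointSeq h36.isCountable (leafStarCentre p))

/-! ### The level kernels of `ψ_{P_n}` -/

/-- The level kernel `ker(ρ_i ∘ ψ_{P_n}) ≤ Leaf n` is open. [cite: MochizukiSemiAnbd2006, Prop 3.6(i) p.38] -/
theorem isOpen_ker_proj_comp_psiLeaf (n i : ℕ) :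
    IsOpen (((((metabelianLeafStar p).galoisLevelData h36).proj h36.isCountable i).comp (psiLeaf P₀ n)).ker :
      Set (Iw.Leaf (p := p) n)) := by
  have hc : Continuous fun x : Iw.Leaf (p := p) n =>
      ((metabelianLeafStar p).galoisLevelData h36).proj h36.isCountable i (psiLeaf P₀ n x) :=
    (((metabelianLeafStar p).galoisLevelData h36).continuous_proj h36.isCountable i).comp
      (leafSeq P₀ n).continuous_decompHom
  exact (isOpen_discrete ({1} : Set (((metabelianLeafStar p).galoisLevelData h36).Gal h36.isCountable i))).preimage hc

/-- The level kernels decrease. [cite: MochizukiSemiAnbd2006, Prop 3.6(i) p.38] -/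
theorem ker_proj_comp_psiLeaf_anti (n : ℕ) ⦃i i' : ℕ⦄ (h : i ≤ i') :
    ((((metabelianLeafStar p).galoisLevelData h36).proj h36.isCountable i').comp (psiLeaf P₀ n)).ker ≤
      ((((metabelianLeafStar p).galoisLevelData h36).proj h36.isCountable i).comp (psiLeaf P₀ n)).ker := by
  intro x hx
  rw [MonoidHom.mem_ker, MonoidHom.comp_apply] at hx ⊢
  exact proj_eq_one_of_le h _ hx

/-- The level kernels have trivial intersection (`ψ_{P_n}` is injective, Thm 3.7 (i), and `π₁^temp = lim`).
[cite: MochizukiSemiAnbd2006, Thm 3.7(i) p.40] -/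
theorem eq_one_of_forall_mem_ker_proj_comp_psiLeaf (n : ℕ) (x : Iw.Leaf (p := p) n)
    (hx : ∀ i, x ∈ ((((metabelianLeafStar p).galoisLevelData h36).proj h36.isCountable i).comp (psiLeaf P₀ n)).ker) :
    x = 1 := by
  have hinj : Function.Injective (leafSeq P₀ n).decompHomCont :=
    (verticialInjective_holds _ (metabelianLeafStar_thm37Hypotheses' p) ((metabelianLeafStar p).temperedPiChart h36)
      (leafStarLeaf p n)).2 _ (leafSeq P₀ n).isVerticialHom_decompHomCont
  have h1 : psiLeaf P₀ n x = 1 :=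
    ((metabelianLeafStar p).galoisLevelData h36).pi_ext h36.isCountable fun i => by
      rw [map_one]; exact hx i
  have h2 : (leafSeq P₀ n).decompHomCont x = (leafSeq P₀ n).decompHomCont 1 := by
    rw [map_one]; exact h1
  exact hinj h2

/-! ### LEAF-LOCAL COLLAPSE -/

/-- **Reading `d` through a fixed glued edge from the LEAF side.**  If `d` fixes the glued edge of the centre
translate `(x ψ_n(l))·P₀` along `(n, true)` at level `i`, then `ρ_i(d) = ρ_i(x ψ_n(l s(κ) l⁻¹) x⁻¹)` for some
`κ ∈ ℤ_p` (the edge is the glued edge of the leaf translate `(x ψ_n(l))·P_n` along `(n, false)`, whose edge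
decomposition homomorphism is `ψ ∘ s`; abc-iut-L3-t8 gen 5's `exists_galE_eq_proj_of_fixes`).
[cite: MochizukiSemiAnbd2006, Rmk 2.2.1 p.24] -/
theorem exists_proj_eq_leafConj_of_fixes_gluedEdge (n i : ℕ)
    (d x : ((metabelianLeafStar p).galoisLevelData h36).temperedPi h36.isCountable) (l : Iw.Leaf (p := p) n)
    (hfix : (((metabelianLeafStar p).galoisLevelData h36).treeAct h36.isCountable i d).hom.edgeMap
      (((P₀.smul (x * psiLeaf P₀ n l)).toEdgeSeq ((n, true) : ℕ × Bool) (leafStar_abuts_true' p n)).edge i) =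
      ((P₀.smul (x * psiLeaf P₀ n l)).toEdgeSeq ((n, true) : ℕ × Bool) (leafStar_abuts_true' p n)).edge i) :
    ∃ κ : Multiplicative ℤ_[p], ((metabelianLeafStar p).galoisLevelData h36).proj h36.isCountable i d =
      ((metabelianLeafStar p).galoisLevelData h36).proj h36.isCountable i
        (x * psiLeaf P₀ n (l * Iw.lowHom n κ * l⁻¹) * x⁻¹) := by
  let Dg := (metabelianLeafStar p).galoisLevelData h36
  set T := ((leafSeq P₀ n).smul (x * psiLeaf P₀ n l)).toEdgeSeq ((n, false) : ℕ × Bool)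
    (leafStar_abuts_false' p n) with hT
  have hTedge : T.edge i = ((P₀.smul (x * psiLeaf P₀ n l)).toEdgeSeq ((n, true) : ℕ × Bool)
      (leafStar_abuts_true' p n)).edge i :=
    congrArg (fun X => GaloisLevelData.EdgeSeq.edge X i) (toEdgeSeq_leafSeq_smul P₀ (x * psiLeaf P₀ n l) n)
  rw [← hTedge] at hfix
  obtain ⟨κ, hκ⟩ := T.exists_galE_eq_proj_of_fixes h36.isConnected i d hfix
  refine ⟨κ, ?_⟩
  rw [← hκ, ← T.proj_decompHomE h36.isConnected i κ, hT,
    ((leafSeq P₀ n).smul (x * psiLeaf P₀ n l)).decompHomE_toEdgeSeq ((n, false) : ℕ × Bool)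
      (leafStar_abuts_false' p n) h36.isConnected, MonoidHom.comp_apply,
    GaloisLevelData.PointSeq.decompHom_smul]
  congr 1
  change x * psiLeaf P₀ n l * psiLeaf P₀ n (Iw.lowHom n κ) * (x * psiLeaf P₀ n l)⁻¹ =
    x * psiLeaf P₀ n (l * Iw.lowHom n κ * l⁻¹) * x⁻¹
  rw [map_mul (psiLeaf P₀ n), map_mul (psiLeaf P₀ n), map_inv (psiLeaf P₀ n), mul_inv_rev]
  group

include P₀ in
/-- **LEAF-LOCAL COLLAPSE.**  Let the `a`-character `Φ₀` modulo `p^{e₀}` (leaf values `(1 + 0·pᵐ)·log`, killing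
`ker ρ_j` for `j ≥ j₀`) see `d`.  For every `j` there is a level `I` such that for all `i ≥ I`, `x ∈ π₁^temp` and
`l₁, l₂ ∈ Leaf n`: if `d` fixes the glued edges of BOTH centre translates `(x ψ_n(l₁))·P₀`, `(x ψ_n(l₂))·P₀` at
level `i` (two edges at the leaf-type vertex `x·P_n`), then `(x ψ_n(l₁))·P₀` and `(x ψ_n(l₂))·P₀` have the same
vertex at level `j`.  (Both level-`i` readings `x ψ_n(l_k s(κ_k) l_k⁻¹) x⁻¹` of `d` agree, `κ₁ ≢ 0 (p^{e₀})` as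
`Φ₀(d) = κ₁`; asymptotic malnormality of the torus gives `l₂⁻¹ l₁ ∈ s(ℤ_p)·ker(ρ_j ∘ ψ_n)`, and `ψ_n(s(t)) =
ψ₀(θα n t)` fixes `P₀`'s vertices.) [cite: MochizukiSemiAnbd2006, Rmk 2.2.1 p.24] -/
theorem exists_level_leafLocalCollapse (n : ℕ) {e₀ : ℕ}
    (Φ₀ : ((metabelianLeafStar p).galoisLevelData h36).temperedPi h36.isCountable →* Multiplicative (ZMod (p ^ e₀)))
    (hΦ₀L : ∀ (m : ℕ) (Q : ((metabelianLeafStar p).galoisLevelData h36).PointSeq h36.isCountable (leafStarLeaf p m))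
      (y : Iw.Leaf (p := p) m), Φ₀ (Q.decompHom y) = Iw.logChar m e₀ (1 + 0 * (p : ZMod (p ^ e₀)) ^ m) y)
    {j₀ : ℕ} (hker₀ : ∀ j, j₀ ≤ j → ∀ g, ((metabelianLeafStar p).galoisLevelData h36).proj h36.isCountable j g = 1 →
      Φ₀ g = 1)
    (d : ((metabelianLeafStar p).galoisLevelData h36).temperedPi h36.isCountable) (hΦ₀d : Φ₀ d ≠ 1) (j : ℕ) :
    ∃ I : ℕ, ∀ i, I ≤ i → ∀ (x : ((metabelianLeafStar p).galoisLevelData h36).temperedPi h36.isCountable)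
      (l₁ l₂ : Iw.Leaf (p := p) n),
      (((metabelianLeafStar p).galoisLevelData h36).treeAct h36.isCountable i d).hom.edgeMap
        (((P₀.smul (x * psiLeaf P₀ n l₁)).toEdgeSeq ((n, true) : ℕ × Bool) (leafStar_abuts_true' p n)).edge i) =
        ((P₀.smul (x * psiLeaf P₀ n l₁)).toEdgeSeq ((n, true) : ℕ × Bool) (leafStar_abuts_true' p n)).edge i →
      (((metabelianLeafStar p).galoisLevelData h36).treeAct h36.isCountable i d).hom.edgeMap
        (((P₀.smul (x * psiLeaf P₀ n l₂)).toEdgeSeq ((n, true) : ℕ × Bool) (leafStar_abuts_true' p n)).edge i) =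
        ((P₀.smul (x * psiLeaf P₀ n l₂)).toEdgeSeq ((n, true) : ℕ × Bool) (leafStar_abuts_true' p n)).edge i →
      (P₀.smul (x * psiLeaf P₀ n l₁)).vertex j = (P₀.smul (x * psiLeaf P₀ n l₂)).vertex j := by
  haveI : NeZero p := ⟨hp.out.ne_zero⟩
  let Dg := (metabelianLeafStar p).galoisLevelData h36
  have hc := h36.isCountable
  -- asymptotic malnormality along the level kernels of `ψ_n`
  obtain ⟨I, hI⟩ := Iw.exists_level_forall_conj_mem_imp n
    (fun i => ((Dg.proj hc i).comp (psiLeaf P₀ n)).ker) (isOpen_ker_proj_comp_psiLeaf P₀ n)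
    (ker_proj_comp_psiLeaf_anti P₀ n) (eq_one_of_forall_mem_ker_proj_comp_psiLeaf P₀ n) e₀ j
  refine ⟨max I j₀, fun i hi x l₁ l₂ h₁ h₂ => ?_⟩
  obtain ⟨κ₁, hκ₁⟩ := exists_proj_eq_leafConj_of_fixes_gluedEdge P₀ n i d x l₁ h₁
  obtain ⟨κ₂, hκ₂⟩ := exists_proj_eq_leafConj_of_fixes_gluedEdge P₀ n i d x l₂ h₂
  -- `κ₁ ≢ 0 (mod p^{e₀})`: `Φ₀ d = κ₁`
  have hΦval : Φ₀ d = ofAdd (PadicInt.toZModPow e₀ κ₁.toAdd) := by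
    have h1 : Φ₀ (d * (x * psiLeaf P₀ n (l₁ * Iw.lowHom n κ₁ * l₁⁻¹) * x⁻¹)⁻¹) = 1 :=
      hker₀ i ((le_max_right I j₀).trans hi) _ (by rw [map_mul, map_inv, hκ₁, mul_inv_cancel])
    rw [map_mul, map_inv, mul_inv_eq_one] at h1
    rw [h1, map_mul, map_mul, map_inv, mul_inv_cancel_comm,
      show Φ₀ (psiLeaf P₀ n (l₁ * Iw.lowHom n κ₁ * l₁⁻¹)) = Iw.logChar n e₀ (1 + 0 * (p : ZMod (p ^ e₀)) ^ n)
        (l₁ * Iw.lowHom n κ₁ * l₁⁻¹) from hΦ₀L n (leafSeq P₀ n) _,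
      map_mul, map_mul, map_inv, mul_inv_cancel_comm, Iw.logChar_lowHom, zero_mul, add_zero, one_mul]
  have hκ₁0 : PadicInt.toZModPow e₀ κ₁.toAdd ≠ 0 := fun h0 => hΦ₀d (by rw [hΦval, h0, ofAdd_zero])
  -- the two readings agree modulo `ker ρ_i`
  have hker : (Iw.lowHom n κ₂)⁻¹ * (l₂⁻¹ * l₁ * Iw.lowHom n κ₁ * (l₂⁻¹ * l₁)⁻¹) ∈
      ((Dg.proj hc i).comp (psiLeaf P₀ n)).ker := by
    obtain ⟨A₁, hA₁⟩ : ∃ A₁ : Dg.temperedPi hc, psiLeaf P₀ n (l₁ * Iw.lowHom n κ₁ * l₁⁻¹) = A₁ := ⟨_, rfl⟩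
    obtain ⟨A₂, hA₂⟩ : ∃ A₂ : Dg.temperedPi hc, psiLeaf P₀ n (l₂ * Iw.lowHom n κ₂ * l₂⁻¹) = A₂ := ⟨_, rfl⟩
    rw [hA₁] at hκ₁
    rw [hA₂] at hκ₂
    have h12 : Dg.proj hc i (x * A₁ * x⁻¹) = Dg.proj hc i (x * A₂ * x⁻¹) := hκ₁.symm.trans hκ₂
    have h12' : Dg.proj hc i x * Dg.proj hc i A₁ * (Dg.proj hc i x)⁻¹ =
        Dg.proj hc i x * Dg.proj hc i A₂ * (Dg.proj hc i x)⁻¹ := by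
      simpa only [map_mul, map_inv] using h12
    have h13 : Dg.proj hc i A₁ = Dg.proj hc i A₂ := mul_left_cancel (mul_right_cancel h12')
    have h4 : Dg.proj hc i (A₂⁻¹ * A₁) = 1 := by rw [map_mul, map_inv, h13, inv_mul_cancel]
    have h5 : (Iw.lowHom n κ₂)⁻¹ * (l₂⁻¹ * l₁ * Iw.lowHom n κ₁ * (l₂⁻¹ * l₁)⁻¹) =
        l₂⁻¹ * ((l₂ * Iw.lowHom n κ₂ * l₂⁻¹)⁻¹ * (l₁ * Iw.lowHom n κ₁ * l₁⁻¹)) * l₂ := by group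
    rw [MonoidHom.mem_ker, MonoidHom.comp_apply, h5, map_mul (psiLeaf P₀ n), map_mul (psiLeaf P₀ n),
      map_mul (psiLeaf P₀ n), map_inv (psiLeaf P₀ n), map_inv (psiLeaf P₀ n), hA₁, hA₂,
      map_mul (Dg.proj hc i), map_mul (Dg.proj hc i), h4, mul_one, ← map_mul (Dg.proj hc i), inv_mul_cancel,
      map_one]
  obtain ⟨t, ht⟩ := hI i ((le_max_left I j₀).trans hi) (l₂⁻¹ * l₁) κ₁ κ₂ hκ₁0 hker
  -- conclusion on the level-`j` vertices
  rw [MonoidHom.mem_ker, MonoidHom.comp_apply] at ht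
  have hsplit : x * psiLeaf P₀ n l₁ =
      x * psiLeaf P₀ n l₂ * psiLeaf P₀ n (Iw.lowHom n t) * psiLeaf P₀ n ((Iw.lowHom n t)⁻¹ * (l₂⁻¹ * l₁)) := by
    rw [mul_assoc (x * psiLeaf P₀ n l₂), ← map_mul, mul_inv_cancel_left, mul_assoc, ← map_mul, mul_inv_cancel_left]
  rw [GaloisLevelData.PointSeq.smul_vertex, GaloisLevelData.PointSeq.smul_vertex, hsplit, map_mul, map_mul,
    Dg.treeAct_eq_one_of_mem_ker j (MonoidHom.mem_ker.mpr ht), mul_one]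
  change ((Dg.treeAct hc j (x * psiLeaf P₀ n l₂)).hom.vertexMap ∘
      (Dg.treeAct hc j (psiLeaf P₀ n (Iw.lowHom n t))).hom.vertexMap) (P₀.vertex j) = _
  rw [Function.comp_apply, psiLeaf_lowHom]
  change (Dg.treeAct hc j (x * psiLeaf P₀ n l₂)).hom.vertexMap
      ((Dg.treeAct hc j (P₀.decompHom (FreeProPRankTwo.θα p n t))).hom.vertexMap (P₀.vertex j)) = _
  rw [P₀.treeAct_decompHom_vertexMap]

/-! ### One step of a walk, with the edge identified as a glued edge -/

/-- **Centre step, edge form**: a branch `c` at the centre-type vertex `(g·P₀).vertex N` over `(m, true)` has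
edge the glued edge of a centre translate `x·P₀` with the same vertex, and the far end of that edge is the
leaf-type vertex `(x·P_m).vertex N`. [cite: MochizukiSemiAnbd2006, Rmk 2.2.1 p.24] -/
theorem exists_centre_smul_of_branch
    (g : ((metabelianLeafStar p).galoisLevelData h36).temperedPi h36.isCountable) (N m : ℕ)
    (c c' : (((metabelianLeafStar p).galoisLevelData h36).tree N).Branch)
    (hcb : (((metabelianLeafStar p).galoisLevelData h36).treeProj N).branchMap c = ((m, true) : ℕ × Bool))
    (hc : (((metabelianLeafStar p).galoisLevelData h36).tree N).abuts c = some ((P₀.smul g).vertex N))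
    (hcc' : c ≠ c')
    (hee : (((metabelianLeafStar p).galoisLevelData h36).tree N).edgeOf c' =
      (((metabelianLeafStar p).galoisLevelData h36).tree N).edgeOf c)
    {z : (((metabelianLeafStar p).galoisLevelData h36).tree N).Vertex}
    (hc' : (((metabelianLeafStar p).galoisLevelData h36).tree N).abuts c' = some z) :
    ∃ x : ((metabelianLeafStar p).galoisLevelData h36).temperedPi h36.isCountable,
      (P₀.smul x).vertex N = (P₀.smul g).vertex N ∧
      (((metabelianLeafStar p).galoisLevelData h36).tree N).edgeOf c =
        ((P₀.smul x).toEdgeSeq ((m, true) : ℕ × Bool) (leafStar_abuts_true' p m)).edge N ∧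
      z = ((leafSeq P₀ m).smul x).vertex N := by
  obtain ⟨gᵥ, hedge⟩ := (P₀.smul g).exists_edgeOf_eq_toEdgeSeq_edge N ((m, true) : ℕ × Bool)
    (leafStar_abuts_true' p m) c hcb hc
  have hPa : (P₀.smul g).smul ((P₀.smul g).decompHom gᵥ⁻¹) = P₀.smul (g * psi0 P₀ gᵥ⁻¹) := by
    rw [GaloisLevelData.PointSeq.decompHom_smul, GaloisLevelData.PointSeq.smul_smul, inv_mul_cancel_right]
    rfl
  have hvert : (P₀.smul (g * psi0 P₀ gᵥ⁻¹)).vertex N = (P₀.smul g).vertex N := by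
    rw [← hPa]; exact (P₀.smul g).smul_decompHom_vertex gᵥ⁻¹ N
  rw [hPa] at hedge
  have hj := joins_toEdgeSeq_edge P₀ (g * psi0 P₀ gᵥ⁻¹) N m
  rw [hvert] at hj
  have hz := SemiGraph.abuts_eq_of_joins (((metabelianLeafStar p).galoisLevelData h36).isTree_tree N).isTree.isAcyclic
    hj hedge (hee.trans hedge) hcc' hc
  rw [hc'] at hz
  exact ⟨g * psi0 P₀ gᵥ⁻¹, hvert, hedge, Option.some.inj hz⟩

/-- **Leaf step, edge form**: a branch `c` at the leaf-type vertex `(a·P_m).vertex N` (over `(m, false)`) has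
edge the glued edge of the centre translate `(a ψ_m(l))·P₀` for some `l ∈ Leaf m`, whose centre-type vertex is
the far end. [cite: MochizukiSemiAnbd2006, Rmk 2.2.1 p.24] -/
theorem exists_leaf_smul_of_branch
    (a : ((metabelianLeafStar p).galoisLevelData h36).temperedPi h36.isCountable) (N m : ℕ)
    (c c' : (((metabelianLeafStar p).galoisLevelData h36).tree N).Branch)
    (hcb : (((metabelianLeafStar p).galoisLevelData h36).treeProj N).branchMap c = ((m, false) : ℕ × Bool))
    (hc : (((metabelianLeafStar p).galoisLevelData h36).tree N).abuts c =
      some (((leafSeq P₀ m).smul a).vertex N))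
    (hcc' : c ≠ c')
    (hee : (((metabelianLeafStar p).galoisLevelData h36).tree N).edgeOf c' =
      (((metabelianLeafStar p).galoisLevelData h36).tree N).edgeOf c)
    {z : (((metabelianLeafStar p).galoisLevelData h36).tree N).Vertex}
    (hc' : (((metabelianLeafStar p).galoisLevelData h36).tree N).abuts c' = some z) :
    ∃ l : Iw.Leaf (p := p) m,
      (((metabelianLeafStar p).galoisLevelData h36).tree N).edgeOf c =
        ((P₀.smul (a * psiLeaf P₀ m l)).toEdgeSeq ((m, true) : ℕ × Bool) (leafStar_abuts_true' p m)).edge N ∧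
      z = (P₀.smul (a * psiLeaf P₀ m l)).vertex N := by
  obtain ⟨lᵥ, hedge⟩ := ((leafSeq P₀ m).smul a).exists_edgeOf_eq_toEdgeSeq_edge N ((m, false) : ℕ × Bool)
    (leafStar_abuts_false' p m) c hcb hc
  have hLa : ((leafSeq P₀ m).smul a).smul (((leafSeq P₀ m).smul a).decompHom lᵥ⁻¹) =
      (leafSeq P₀ m).smul (a * psiLeaf P₀ m lᵥ⁻¹) := by
    rw [GaloisLevelData.PointSeq.decompHom_smul, GaloisLevelData.PointSeq.smul_smul, inv_mul_cancel_right]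
    rfl
  have hvert : ((leafSeq P₀ m).smul (a * psiLeaf P₀ m lᵥ⁻¹)).vertex N = ((leafSeq P₀ m).smul a).vertex N := by
    rw [← hLa]; exact ((leafSeq P₀ m).smul a).smul_decompHom_vertex lᵥ⁻¹ N
  rw [hLa] at hedge
  have hedge' : (((metabelianLeafStar p).galoisLevelData h36).tree N).edgeOf c =
      ((P₀.smul (a * psiLeaf P₀ m lᵥ⁻¹)).toEdgeSeq ((m, true) : ℕ × Bool) (leafStar_abuts_true' p m)).edge N :=
    hedge.trans (congrArg (fun X => GaloisLevelData.EdgeSeq.edge X N) (toEdgeSeq_leafSeq_smul P₀ _ m))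
  have hj := joins_toEdgeSeq_edge P₀ (a * psiLeaf P₀ m lᵥ⁻¹) N m
  rw [hvert] at hj
  obtain ⟨b₁, b₂, hne, hb₁e, hb₂e, hb₁, hb₂⟩ := hj
  have hz := SemiGraph.abuts_eq_of_joins (((metabelianLeafStar p).galoisLevelData h36).isTree_tree N).isTree.isAcyclic
    ⟨b₂, b₁, hne.symm, hb₂e, hb₁e, hb₂, hb₁⟩ hedge' (hee.trans hedge') hcc' hc
  rw [hc'] at hz
  exact ⟨lᵥ⁻¹, hedge', Option.some.inj hz⟩

end ProfiniteSemiGraph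

end Literature.AnabelianGeometry.SemiGraphs

end
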